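import Summits.ResolutionOfSingularities.ResolutionOfSingularities.Theorems.RadicialJungCleanModelsF75cTripleStep
import HarnessLib

/-!
# [F-75c discharge, brick L2] Removing triple points: a GOOD configuration is blown up at points lying on three
# members until no point lies on three members (The Stacks Project, Lemma 54.15.6 = Tag 0BIC, proof ¶2:
# «continuing to blowup points where more than 3 [sic] of the components of `Z` meet»)

Cell res-hironaka, D-0154 INPUTS discharger `res-inputs-p-f75c` for the named fact F-75c
`Literature.AlgebraicGeometry.Resolution.Stacks0BIC_embeddedResolutionCurvesInSurfaces_locus`
(`--supports stmt-ResolutionOfSingularities-15917 --as helper`). For a GOOD configuration (members regular, pairwise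
transversal) the TRIPLE POINTS — points lying on three distinct members — form a finite set; blowing one of them up
yields a GOOD configuration (brick C4) whose triple points map injectively into the remaining ones (two distinct
strict transforms never meet over the centre, brick C3), so the count drops and the process stops.

* `finite_triplePoints` — finiteness; `ncard_triplePoints_successor_lt` — the count drops;
* **`exists_good_noTriplePoint`** — from a reachable GOOD configuration, a further composition of point blow-ups over
  `⋃ 𝒞₀` reaches a reachable GOOD configuration with no triple point.

HONEST FRAMING: bookkeeping over this seat's bricks C1–C4 and tree theorems; nothing here is a statement of
[Hironaka2017]. AI-written; AI review is weaker than expert review. References: The Stacks Project, Tag 0BIC [StacksProject].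
-/

noncomputable section

set_option linter.dupNamespace false -- mandated namespace of this single-conjunct summit

open CategoryTheory AlgebraicGeometry TopologicalSpace IsLocalRing

namespace Summit.ResolutionOfSingularities.ResolutionOfSingularities.Theorems

namespace F75c

open Literature.AlgebraicGeometry.Resolution
open Literature.AlgebraicGeometry.Resolution.CurveConfiguration
open Summit.ResolutionOfSingularities.ResolutionOfSingularities.Theorems.CP2008Prop44
open Scheme.IdealSheafData

universe u

/-! ## Triple points -/

section Triple

variable {Y : Scheme.{u}}

/-- **The triple points of a finite configuration of members form a finite set** (two distinct members meet in
finitely many points). [cite: StacksProject, Tag 0BIC (Lemma 54.15.6, proof ¶2)] -/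
theorem finite_triplePoints [IsNoetherian Y] (hqe : Scheme.IsQuasiExcellent Y) (hY2 : topologicalKrullDim Y ≤ 2)
    {𝒞 : Set (Closeds Y)} (hfin : 𝒞.Finite)
    (hmem : ∀ C ∈ 𝒞, ∃ η : Y, (C : Set Y) = closure {η} ∧ ¬ IsClosed ({η} : Set Y) ∧
      ringKrullDim (Y.presheaf.stalk η) = 1) :
    {q : Y | ∃ C₁ ∈ 𝒞, ∃ C₂ ∈ 𝒞, ∃ C₃ ∈ 𝒞, C₁ ≠ C₂ ∧ C₁ ≠ C₃ ∧ C₂ ≠ C₃ ∧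
      q ∈ (C₁ : Set Y) ∧ q ∈ (C₂ : Set Y) ∧ q ∈ (C₃ : Set Y)}.Finite := by
  have hpair : ∀ C ∈ 𝒞, ∀ C' ∈ 𝒞, C ≠ C' → ((C : Set Y) ∩ (C' : Set Y)).Finite := by
    intro C hC C' hC' hne
    obtain ⟨η, hCη, hηcl, hη1⟩ := hmem C hC
    obtain ⟨η', hC'η', -, hη'1⟩ := hmem C' hC'
    have hCeq : C = ⟨closure {η}, isClosed_closure⟩ := Closeds.ext hCη
    obtain ⟨hint, hnoeth, -, hdim1⟩ := member_props hqe hY2 hη1 hηcl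
    rw [← hCeq] at hint hnoeth hdim1
    haveI := hint; haveI := hnoeth
    exact finite_inter_of_not_subset C C' hdim1 fun hsub => hne (eq_of_subset_of_isMember hCη hη1 hC'η' hη'1 hsub)
  refine ((hfin.biUnion fun C hC => hfin.biUnion fun C' hC' =>
    (show ({q : Y | C ≠ C' ∧ q ∈ (C : Set Y) ∧ q ∈ (C' : Set Y)}).Finite from ?_))).subset ?_
  · by_cases hne : C ≠ C'
    · exact (hpair C hC C' hC' hne).subset fun q hq => ⟨hq.2.1, hq.2.2⟩
    · exact (Set.finite_empty).subset fun q hq => (hne hq.1).elim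
  · rintro q ⟨C₁, hC₁, C₂, hC₂, -, -, h12, -, -, hq1, hq2, -⟩
    exact Set.mem_biUnion hC₁ (Set.mem_biUnion hC₂ ⟨h12, hq1, hq2⟩)

end Triple

/-! ## One blow-up at a triple point lowers the count -/

section Step

variable {X Y Y' : Scheme.{u}} [IsNoetherian X] [IsNoetherian Y] {σ : Y ⟶ X} {T : Set X} {x : Y}
  {hx : IsClosed ({x} : Set Y)} {π : Y' ⟶ Y}

/-- **Over the centre no point of the successor of a GOOD configuration lies on two members other than `E`.**
[cite: StacksProject, Tag 0BIC (Lemma 54.15.6, proof ¶2)] -/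
theorem eq_of_mem_strictTransform_of_apply_eq (hreg : Scheme.IsRegular X) (hexc : Scheme.IsExcellent X)
    (hX2 : topologicalKrullDim X ≤ 2) {𝒞 : Set (Closeds Y)} (hIPC : IsPointBlowupComposition T σ)
    (hmem : ∀ C ∈ 𝒞, ∃ η : Y, (C : Set Y) = closure {η} ∧ ¬ IsClosed ({η} : Set Y) ∧
      ringKrullDim (Y.presheaf.stalk η) = 1)
    (hregC : ∀ C ∈ 𝒞, Scheme.IsRegular (vanishingIdeal C).subscheme)
    (htr : ∀ C ∈ 𝒞, ∀ C' ∈ 𝒞, C ≠ C' → ∀ q ∈ (C : Set Y) ∩ (C' : Set Y),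
      stalkIdeal (vanishingIdeal C) q ⊔ stalkIdeal (vanishingIdeal C') q = maximalIdeal (Y.presheaf.stalk q))
    (hπ : IsBlowup π (vanishingIdeal ⟨{x}, hx⟩)) {C C' : Closeds Y} (hC : C ∈ 𝒞) (hC' : C' ∈ 𝒞) {q : Y'}
    (hqx : π q = x) (hqC : q ∈ closure (π ⁻¹' ((C : Set Y) \ {x}))) (hqC' : q ∈ closure (π ⁻¹' ((C' : Set Y) \ {x}))) :
    C = C' := by
  by_contra hne
  obtain ⟨-, hregY, hexcY, hY2⟩ := IsPointBlowupComposition.invariants hIPC hreg hexc hX2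
  have hqeY := hexcY.isQuasiExcellent
  haveI : IsProper π := hπ.isProper
  haveI : IsLocallyNoetherian Y' := LocallyOfFiniteType.isLocallyNoetherian π
  obtain ⟨η, hCη, hηcl, hη1⟩ := hmem C hC
  obtain ⟨η', hC'η', hη'cl, hη'1⟩ := hmem C' hC'
  have hCeq : C = ⟨closure {η}, isClosed_closure⟩ := Closeds.ext hCη
  have hC'eq : C' = ⟨closure {η'}, isClosed_closure⟩ := Closeds.ext hC'η'
  obtain ⟨hint, -, -, hdim1⟩ := member_props hqeY hY2 hη1 hηcl
  obtain ⟨hint', -, -, hdim1'⟩ := member_props hqeY hY2 hη'1 hη'cl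
  rw [← hCeq] at hint hdim1
  rw [← hC'eq] at hint' hdim1'
  haveI := hint; haveI := hint'
  have hxC : x ∈ (C : Set Y) := by
    by_contra hxC
    have hempty := closure_preimage_diff_inter_preimage_singleton_eq_empty π.continuous C hxC
    exact (Set.eq_empty_iff_forall_notMem.mp hempty) q ⟨hqC, hqx⟩
  have hxC' : x ∈ (C' : Set Y) := by
    by_contra hxC'
    have hempty := closure_preimage_diff_inter_preimage_singleton_eq_empty π.continuous C' hxC'
    exact (Set.eq_empty_iff_forall_notMem.mp hempty) q ⟨hqC', hqx⟩
  have hnsub : ¬ (C : Set Y) ⊆ C' := fun hsub => hne (eq_of_subset_of_isMember hCη hη1 hC'η' hη'1 hsub)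
  have hempty := strictTransform_inter_strictTransform_inter_fibre_eq_empty hπ C C' hdim1 hdim1' hnsub hxC hxC'
    (forall_not_mem_of_isRegular_subscheme C (hregC C hC) x) (htr C hC C' hC' hne x ⟨hxC, hxC'⟩)
  exact (Set.eq_empty_iff_forall_notMem.mp hempty) q ⟨⟨hqC, hqC'⟩, hqx⟩

omit [AlgebraicGeometry.IsNoetherian Y] in
/-- **Blowing up a triple point of a GOOD configuration lowers the number of triple points**: the triple points of
the successor lie off the exceptional fibre (over the centre at most `E` and one strict transform pass through a
point) and map injectively to triple points other than the centre. [cite: StacksProject, Tag 0BIC (Lemma 54.15.6, proof ¶2)] -/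
theorem ncard_triplePoints_successor_lt (hreg : Scheme.IsRegular X) (hexc : Scheme.IsExcellent X)
    (hX2 : topologicalKrullDim X ≤ 2) {𝒞 : Set (Closeds Y)} (hIPC : IsPointBlowupComposition T σ) (hfin : 𝒞.Finite)
    (hmem : ∀ C ∈ 𝒞, ∃ η : Y, (C : Set Y) = closure {η} ∧ ¬ IsClosed ({η} : Set Y) ∧
      ringKrullDim (Y.presheaf.stalk η) = 1)
    (hregC : ∀ C ∈ 𝒞, Scheme.IsRegular (vanishingIdeal C).subscheme)
    (htr : ∀ C ∈ 𝒞, ∀ C' ∈ 𝒞, C ≠ C' → ∀ q ∈ (C : Set Y) ∩ (C' : Set Y),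
      stalkIdeal (vanishingIdeal C) q ⊔ stalkIdeal (vanishingIdeal C') q = maximalIdeal (Y.presheaf.stalk q))
    (hπ : IsBlowup π (vanishingIdeal ⟨{x}, hx⟩))
    (hxT : x ∈ {q : Y | ∃ C₁ ∈ 𝒞, ∃ C₂ ∈ 𝒞, ∃ C₃ ∈ 𝒞, C₁ ≠ C₂ ∧ C₁ ≠ C₃ ∧ C₂ ≠ C₃ ∧
      q ∈ (C₁ : Set Y) ∧ q ∈ (C₂ : Set Y) ∧ q ∈ (C₃ : Set Y)}) :
    {q : Y' | ∃ C₁ ∈ (fun C : Closeds Y => (⟨closure (π ⁻¹' ((C : Set Y) \ {x})), isClosed_closure⟩ : Closeds Y')) ''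
          𝒞 ∪ {⟨π ⁻¹' {x}, hx.preimage π.continuous⟩},
        ∃ C₂ ∈ (fun C : Closeds Y => (⟨closure (π ⁻¹' ((C : Set Y) \ {x})), isClosed_closure⟩ : Closeds Y')) ''
          𝒞 ∪ {⟨π ⁻¹' {x}, hx.preimage π.continuous⟩},
        ∃ C₃ ∈ (fun C : Closeds Y => (⟨closure (π ⁻¹' ((C : Set Y) \ {x})), isClosed_closure⟩ : Closeds Y')) ''
          𝒞 ∪ {⟨π ⁻¹' {x}, hx.preimage π.continuous⟩},
        C₁ ≠ C₂ ∧ C₁ ≠ C₃ ∧ C₂ ≠ C₃ ∧ q ∈ (C₁ : Set Y') ∧ q ∈ (C₂ : Set Y') ∧ q ∈ (C₃ : Set Y')}.ncard <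
      {q : Y | ∃ C₁ ∈ 𝒞, ∃ C₂ ∈ 𝒞, ∃ C₃ ∈ 𝒞, C₁ ≠ C₂ ∧ C₁ ≠ C₃ ∧ C₂ ≠ C₃ ∧
        q ∈ (C₁ : Set Y) ∧ q ∈ (C₂ : Set Y) ∧ q ∈ (C₃ : Set Y)}.ncard := by
  classical
  obtain ⟨hN, hregY, hexcY, hY2⟩ := IsPointBlowupComposition.invariants hIPC hreg hexc hX2
  haveI := hN
  have hqeY := hexcY.isQuasiExcellent
  have hTfin := finite_triplePoints hqeY hY2 hfin hmem
  have hsupp : ((vanishingIdeal (⟨{x}, hx⟩ : Closeds Y)).support : Set Y) = {x} :=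
    Scheme.IdealSheafData.coe_support_vanishingIdeal _
  -- key: over the centre no two distinct non-exceptional members share a point
  have key := fun {C C' : Closeds Y} (hC : C ∈ 𝒞) (hC' : C' ∈ 𝒞) {q : Y'} (hqx : π q = x)
      (hqC : q ∈ closure (π ⁻¹' ((C : Set Y) \ {x}))) (hqC' : q ∈ closure (π ⁻¹' ((C' : Set Y) \ {x}))) =>
    eq_of_mem_strictTransform_of_apply_eq hreg hexc hX2 hIPC hmem hregC htr hπ hC hC' hqx hqC hqC'
  -- every triple point upstairs lies off the fibre and over a triple point other than `x`
  have hmap : ∀ q ∈ {q : Y' | ∃ C₁ ∈ (fun C : Closeds Y =>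
          (⟨closure (π ⁻¹' ((C : Set Y) \ {x})), isClosed_closure⟩ : Closeds Y')) '' 𝒞 ∪
            {⟨π ⁻¹' {x}, hx.preimage π.continuous⟩},
        ∃ C₂ ∈ (fun C : Closeds Y => (⟨closure (π ⁻¹' ((C : Set Y) \ {x})), isClosed_closure⟩ : Closeds Y')) ''
          𝒞 ∪ {⟨π ⁻¹' {x}, hx.preimage π.continuous⟩},
        ∃ C₃ ∈ (fun C : Closeds Y => (⟨closure (π ⁻¹' ((C : Set Y) \ {x})), isClosed_closure⟩ : Closeds Y')) ''
          𝒞 ∪ {⟨π ⁻¹' {x}, hx.preimage π.continuous⟩},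
        C₁ ≠ C₂ ∧ C₁ ≠ C₃ ∧ C₂ ≠ C₃ ∧ q ∈ (C₁ : Set Y') ∧ q ∈ (C₂ : Set Y') ∧ q ∈ (C₃ : Set Y')},
      π q ≠ x ∧ π q ∈ {q : Y | ∃ C₁ ∈ 𝒞, ∃ C₂ ∈ 𝒞, ∃ C₃ ∈ 𝒞, C₁ ≠ C₂ ∧ C₁ ≠ C₃ ∧ C₂ ≠ C₃ ∧
        q ∈ (C₁ : Set Y) ∧ q ∈ (C₂ : Set Y) ∧ q ∈ (C₃ : Set Y)} := by
    rintro q ⟨D₁, hD₁, D₂, hD₂, D₃, hD₃, h12, h13, h23, hq1, hq2, hq3⟩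
    -- first: `π q ≠ x`
    have hqx : π q ≠ x := by
      intro hqx
      -- among three distinct members through `q`, two are strict transforms
      rcases hD₁ with ⟨C₁, hC₁, rfl⟩ | hD₁ <;> rcases hD₂ with ⟨C₂, hC₂, rfl⟩ | hD₂
      · exact h12 (by rw [key hC₁ hC₂ hqx hq1 hq2])
      · rcases hD₃ with ⟨C₃, hC₃, rfl⟩ | hD₃
        · exact h13 (by rw [key hC₁ hC₃ hqx hq1 hq3])
        · exact h23 ((Set.mem_singleton_iff.mp hD₂).trans (Set.mem_singleton_iff.mp hD₃).symm)
      · rcases hD₃ with ⟨C₃, hC₃, rfl⟩ | hD₃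
        · exact h23 (by rw [key hC₂ hC₃ hqx hq2 hq3])
        · exact h13 ((Set.mem_singleton_iff.mp hD₁).trans (Set.mem_singleton_iff.mp hD₃).symm)
      · exact h12 ((Set.mem_singleton_iff.mp hD₁).trans (Set.mem_singleton_iff.mp hD₂).symm)
    refine ⟨hqx, ?_⟩
    -- no member through `q` is `E`
    have hE : ∀ {D : Closeds Y'}, q ∈ (D : Set Y') → D ∈ (fun C : Closeds Y =>
        (⟨closure (π ⁻¹' ((C : Set Y) \ {x})), isClosed_closure⟩ : Closeds Y')) '' 𝒞 ∪
          {⟨π ⁻¹' {x}, hx.preimage π.continuous⟩} →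
        ∃ C ∈ 𝒞, D = ⟨closure (π ⁻¹' ((C : Set Y) \ {x})), isClosed_closure⟩ := by
      rintro D hqD (⟨C, hC, rfl⟩ | hD)
      · exact ⟨C, hC, rfl⟩
      · exfalso
        rw [Set.mem_singleton_iff] at hD
        subst hD
        exact hqx hqD
    obtain ⟨C₁, hC₁, rfl⟩ := hE hq1 hD₁
    obtain ⟨C₂, hC₂, rfl⟩ := hE hq2 hD₂
    obtain ⟨C₃, hC₃, rfl⟩ := hE hq3 hD₃
    refine ⟨C₁, hC₁, C₂, hC₂, C₃, hC₃, fun h => h12 (by rw [h]), fun h => h13 (by rw [h]), fun h => h23 (by rw [h]),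
      (mem_closure_preimage_diff_iff π.continuous C₁ hqx).mp hq1,
      (mem_closure_preimage_diff_iff π.continuous C₂ hqx).mp hq2,
      (mem_closure_preimage_diff_iff π.continuous C₃ hqx).mp hq3⟩
  -- count
  have hinj : Set.InjOn (fun q : Y' => π q) {q : Y' | ∃ C₁ ∈ (fun C : Closeds Y =>
          (⟨closure (π ⁻¹' ((C : Set Y) \ {x})), isClosed_closure⟩ : Closeds Y')) '' 𝒞 ∪
            {⟨π ⁻¹' {x}, hx.preimage π.continuous⟩},
        ∃ C₂ ∈ (fun C : Closeds Y => (⟨closure (π ⁻¹' ((C : Set Y) \ {x})), isClosed_closure⟩ : Closeds Y')) ''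
          𝒞 ∪ {⟨π ⁻¹' {x}, hx.preimage π.continuous⟩},
        ∃ C₃ ∈ (fun C : Closeds Y => (⟨closure (π ⁻¹' ((C : Set Y) \ {x})), isClosed_closure⟩ : Closeds Y')) ''
          𝒞 ∪ {⟨π ⁻¹' {x}, hx.preimage π.continuous⟩},
        C₁ ≠ C₂ ∧ C₁ ≠ C₃ ∧ C₂ ≠ C₃ ∧ q ∈ (C₁ : Set Y') ∧ q ∈ (C₂ : Set Y') ∧ q ∈ (C₃ : Set Y')} := by
    intro q₁ h₁ q₂ h₂ h12
    have hne : π q₂ ∉ ((vanishingIdeal (⟨{x}, hx⟩ : Closeds Y)).support : Set Y) := by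
      rw [hsupp]; exact (hmap q₂ h₂).1
    obtain ⟨q', -, huniq⟩ := hπ.existsUnique_preimage_of_not_mem_support hne
    exact (huniq q₁ h12).trans (huniq q₂ rfl).symm
  have hsub : {q : Y | ∃ C₁ ∈ 𝒞, ∃ C₂ ∈ 𝒞, ∃ C₃ ∈ 𝒞, C₁ ≠ C₂ ∧ C₁ ≠ C₃ ∧ C₂ ≠ C₃ ∧
        q ∈ (C₁ : Set Y) ∧ q ∈ (C₂ : Set Y) ∧ q ∈ (C₃ : Set Y)} \ {x} ⊂
      {q : Y | ∃ C₁ ∈ 𝒞, ∃ C₂ ∈ 𝒞, ∃ C₃ ∈ 𝒞, C₁ ≠ C₂ ∧ C₁ ≠ C₃ ∧ C₂ ≠ C₃ ∧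
        q ∈ (C₁ : Set Y) ∧ q ∈ (C₂ : Set Y) ∧ q ∈ (C₃ : Set Y)} :=
    Set.sdiff_singleton_ssubset.mpr hxT
  have hle : {q : Y' | ∃ C₁ ∈ (fun C : Closeds Y =>
          (⟨closure (π ⁻¹' ((C : Set Y) \ {x})), isClosed_closure⟩ : Closeds Y')) '' 𝒞 ∪
            {⟨π ⁻¹' {x}, hx.preimage π.continuous⟩},
        ∃ C₂ ∈ (fun C : Closeds Y => (⟨closure (π ⁻¹' ((C : Set Y) \ {x})), isClosed_closure⟩ : Closeds Y')) ''
          𝒞 ∪ {⟨π ⁻¹' {x}, hx.preimage π.continuous⟩},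
        ∃ C₃ ∈ (fun C : Closeds Y => (⟨closure (π ⁻¹' ((C : Set Y) \ {x})), isClosed_closure⟩ : Closeds Y')) ''
          𝒞 ∪ {⟨π ⁻¹' {x}, hx.preimage π.continuous⟩},
        C₁ ≠ C₂ ∧ C₁ ≠ C₃ ∧ C₂ ≠ C₃ ∧ q ∈ (C₁ : Set Y') ∧ q ∈ (C₂ : Set Y') ∧ q ∈ (C₃ : Set Y')}.ncard ≤
      ({q : Y | ∃ C₁ ∈ 𝒞, ∃ C₂ ∈ 𝒞, ∃ C₃ ∈ 𝒞, C₁ ≠ C₂ ∧ C₁ ≠ C₃ ∧ C₂ ≠ C₃ ∧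
        q ∈ (C₁ : Set Y) ∧ q ∈ (C₂ : Set Y) ∧ q ∈ (C₃ : Set Y)} \ {x}).ncard :=
    Set.ncard_le_ncard_of_injOn (fun q : Y' => π q) (fun q hq => ⟨(hmap q hq).2, (hmap q hq).1⟩) hinj
      (hTfin.subset Set.sdiff_subset)
  exact lt_of_le_of_lt hle (Set.ncard_lt_ncard hsub hTfin)

end Step

/-! ## The loop -/

section Loop

variable {X : Scheme.{u}} [IsNoetherian X]

/-- **Removing triple points terminates**: from a reachable GOOD configuration `(Y, σ, 𝒞)` over `X` (composition of
point blow-ups over `T`, finite, members, `⋃ 𝒞 = σ⁻¹ T`, members regular and pairwise transversal), a further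
composition of blowing ups at triple points reaches a reachable GOOD configuration with no triple point.
[cite: StacksProject, Tag 0BIC (Lemma 54.15.6, proof ¶2)] -/
theorem exists_good_noTriplePoint (hreg : Scheme.IsRegular X) (hexc : Scheme.IsExcellent X)
    (hX2 : topologicalKrullDim X ≤ 2) {T : Set X} {Y : Scheme.{u}} (σ : Y ⟶ X) (𝒞 : Set (Closeds Y))
    (hIPC : IsPointBlowupComposition T σ) (hfin : 𝒞.Finite)
    (hmem : ∀ C ∈ 𝒞, ∃ η : Y, (C : Set Y) = closure {η} ∧ ¬ IsClosed ({η} : Set Y) ∧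
      ringKrullDim (Y.presheaf.stalk η) = 1)
    (hU : (⋃ C ∈ 𝒞, (C : Set Y)) = σ ⁻¹' T)
    (hregC : ∀ C ∈ 𝒞, Scheme.IsRegular (vanishingIdeal C).subscheme)
    (htr : ∀ C ∈ 𝒞, ∀ C' ∈ 𝒞, C ≠ C' → ∀ q ∈ (C : Set Y) ∩ (C' : Set Y),
      stalkIdeal (vanishingIdeal C) q ⊔ stalkIdeal (vanishingIdeal C') q = maximalIdeal (Y.presheaf.stalk q)) :
    ∃ (Y₁ : Scheme.{u}) (σ₁ : Y₁ ⟶ X) (𝒞₁ : Set (Closeds Y₁)),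
      IsPointBlowupComposition T σ₁ ∧ 𝒞₁.Finite ∧
      (∀ C ∈ 𝒞₁, ∃ η : Y₁, (C : Set Y₁) = closure {η} ∧ ¬ IsClosed ({η} : Set Y₁) ∧
        ringKrullDim (Y₁.presheaf.stalk η) = 1) ∧
      (⋃ C ∈ 𝒞₁, (C : Set Y₁)) = σ₁ ⁻¹' T ∧
      (∀ C ∈ 𝒞₁, Scheme.IsRegular (vanishingIdeal C).subscheme) ∧
      (∀ C ∈ 𝒞₁, ∀ C' ∈ 𝒞₁, C ≠ C' → ∀ q ∈ (C : Set Y₁) ∩ (C' : Set Y₁),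
        stalkIdeal (vanishingIdeal C) q ⊔ stalkIdeal (vanishingIdeal C') q = maximalIdeal (Y₁.presheaf.stalk q)) ∧
      ∀ q : Y₁, ¬ ∃ C₁ ∈ 𝒞₁, ∃ C₂ ∈ 𝒞₁, ∃ C₃ ∈ 𝒞₁, C₁ ≠ C₂ ∧ C₁ ≠ C₃ ∧ C₂ ≠ C₃ ∧
        q ∈ (C₁ : Set Y₁) ∧ q ∈ (C₂ : Set Y₁) ∧ q ∈ (C₃ : Set Y₁) := by
  classical
  -- induction on the number of triple points
  suffices H : ∀ (n : ℕ) {Y : Scheme.{u}} (σ : Y ⟶ X) (𝒞 : Set (Closeds Y)),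
      IsPointBlowupComposition T σ → 𝒞.Finite →
      (∀ C ∈ 𝒞, ∃ η : Y, (C : Set Y) = closure {η} ∧ ¬ IsClosed ({η} : Set Y) ∧
        ringKrullDim (Y.presheaf.stalk η) = 1) →
      (⋃ C ∈ 𝒞, (C : Set Y)) = σ ⁻¹' T →
      (∀ C ∈ 𝒞, Scheme.IsRegular (vanishingIdeal C).subscheme) →
      (∀ C ∈ 𝒞, ∀ C' ∈ 𝒞, C ≠ C' → ∀ q ∈ (C : Set Y) ∩ (C' : Set Y),
        stalkIdeal (vanishingIdeal C) q ⊔ stalkIdeal (vanishingIdeal C') q = maximalIdeal (Y.presheaf.stalk q)) →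
      {q : Y | ∃ C₁ ∈ 𝒞, ∃ C₂ ∈ 𝒞, ∃ C₃ ∈ 𝒞, C₁ ≠ C₂ ∧ C₁ ≠ C₃ ∧ C₂ ≠ C₃ ∧
        q ∈ (C₁ : Set Y) ∧ q ∈ (C₂ : Set Y) ∧ q ∈ (C₃ : Set Y)}.ncard ≤ n →
      ∃ (Y₁ : Scheme.{u}) (σ₁ : Y₁ ⟶ X) (𝒞₁ : Set (Closeds Y₁)),
        IsPointBlowupComposition T σ₁ ∧ 𝒞₁.Finite ∧
        (∀ C ∈ 𝒞₁, ∃ η : Y₁, (C : Set Y₁) = closure {η} ∧ ¬ IsClosed ({η} : Set Y₁) ∧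
          ringKrullDim (Y₁.presheaf.stalk η) = 1) ∧
        (⋃ C ∈ 𝒞₁, (C : Set Y₁)) = σ₁ ⁻¹' T ∧
        (∀ C ∈ 𝒞₁, Scheme.IsRegular (vanishingIdeal C).subscheme) ∧
        (∀ C ∈ 𝒞₁, ∀ C' ∈ 𝒞₁, C ≠ C' → ∀ q ∈ (C : Set Y₁) ∩ (C' : Set Y₁),
          stalkIdeal (vanishingIdeal C) q ⊔ stalkIdeal (vanishingIdeal C') q = maximalIdeal (Y₁.presheaf.stalk q)) ∧
        ∀ q : Y₁, ¬ ∃ C₁ ∈ 𝒞₁, ∃ C₂ ∈ 𝒞₁, ∃ C₃ ∈ 𝒞₁, C₁ ≠ C₂ ∧ C₁ ≠ C₃ ∧ C₂ ≠ C₃ ∧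
          q ∈ (C₁ : Set Y₁) ∧ q ∈ (C₂ : Set Y₁) ∧ q ∈ (C₃ : Set Y₁) from
    H _ σ 𝒞 hIPC hfin hmem hU hregC htr le_rfl
  intro n
  induction n with
  | zero =>
    intro Y σ 𝒞 hIPC hfin hmem hU hregC htr hle
    obtain ⟨hN, -, hexcY, hY2⟩ := IsPointBlowupComposition.invariants hIPC hreg hexc hX2
    haveI := hN
    have hT0 := (Set.ncard_eq_zero (finite_triplePoints hexcY.isQuasiExcellent hY2 hfin hmem)).mp (Nat.le_zero.mp hle)
    refine ⟨Y, σ, 𝒞, hIPC, hfin, hmem, hU, hregC, htr, fun q hq => ?_⟩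
    have : q ∈ ({q : Y | ∃ C₁ ∈ 𝒞, ∃ C₂ ∈ 𝒞, ∃ C₃ ∈ 𝒞, C₁ ≠ C₂ ∧ C₁ ≠ C₃ ∧ C₂ ≠ C₃ ∧
        q ∈ (C₁ : Set Y) ∧ q ∈ (C₂ : Set Y) ∧ q ∈ (C₃ : Set Y)}) := hq
    rw [hT0] at this
    exact this
  | succ n ih =>
    intro Y σ 𝒞 hIPC hfin hmem hU hregC htr hle
    by_cases hemp : {q : Y | ∃ C₁ ∈ 𝒞, ∃ C₂ ∈ 𝒞, ∃ C₃ ∈ 𝒞, C₁ ≠ C₂ ∧ C₁ ≠ C₃ ∧ C₂ ≠ C₃ ∧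
        q ∈ (C₁ : Set Y) ∧ q ∈ (C₂ : Set Y) ∧ q ∈ (C₃ : Set Y)} = ∅
    · refine ⟨Y, σ, 𝒞, hIPC, hfin, hmem, hU, hregC, htr, fun q hq => ?_⟩
      have : q ∈ ({q : Y | ∃ C₁ ∈ 𝒞, ∃ C₂ ∈ 𝒞, ∃ C₃ ∈ 𝒞, C₁ ≠ C₂ ∧ C₁ ≠ C₃ ∧ C₂ ≠ C₃ ∧
          q ∈ (C₁ : Set Y) ∧ q ∈ (C₂ : Set Y) ∧ q ∈ (C₃ : Set Y)}) := hq
      rw [hemp] at this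
      exact this
    obtain ⟨x, hxT⟩ := Set.nonempty_iff_ne_empty.mpr hemp
    obtain ⟨hN, -, hexcY, hY2⟩ := IsPointBlowupComposition.invariants hIPC hreg hexc hX2
    haveI := hN
    -- the triple point is closed and lies on a member
    have hxT' := hxT
    obtain ⟨C₁, hC₁, C₂, hC₂, -, -, h12, -, -, hx1, hx2, -⟩ := hxT'
    have hxcl : IsClosed ({x} : Set Y) := isClosed_of_mem_inter hexcY.isQuasiExcellent hY2 hmem hC₁ hC₂ h12 hx1 hx2
    obtain ⟨Y', π, hπ⟩ := exists_isBlowup Y (vanishingIdeal ⟨{x}, hxcl⟩)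
    obtain ⟨hIPC', hfin', hmem', hU'⟩ := successor_state hreg hexc hX2 hIPC hfin hmem hU hC₁ hx1 hπ
    obtain ⟨hregC', htr'⟩ := good_successor hreg hexc hX2 hIPC hmem hregC htr hπ
    have hlt := ncard_triplePoints_successor_lt hreg hexc hX2 hIPC hfin hmem hregC htr hπ hxT
    exact ih (π ≫ σ) _ hIPC' hfin' hmem' hU' hregC' htr' (by omega)

end Loop

end F75c

end Summit.ResolutionOfSingularities.ResolutionOfSingularities.Theorems

end
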